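import Summits.KontsevichZagierPeriods.KontsevichZagierPeriods.Theorems.LinRedNormalFormHoffmanSpanInKZSpanTransfer
import Summits.KontsevichZagierPeriods.KontsevichZagierPeriods.Theorems.LinRedNormalFormHoffmanSpanInKZEds7
import Summits.KontsevichZagierPeriods.KontsevichZagierPeriods.Theorems.LinRedNormalFormHoffmanSpanInKZEds8
import Summits.KontsevichZagierPeriods.KontsevichZagierPeriods.Theorems.LinRedNormalFormHoffmanSpanInKZEds9
import Summits.KontsevichZagierPeriods.KontsevichZagierPeriods.Theorems.LinRedNormalFormHoffmanSpanInKZEds10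

/-!
# Crux `LinRedNormalForm.HoffmanSpanInKZ` (stmt-KontsevichZagierPeriods-15044), line `Sketch`:
# the crux through weight `10`, unconditionally (registered stub `stub_leTen`)

Assembly of the landed rungs: the EDS certificates of the tree (`stub_edsCertificateLow`, `N ≤ 6`) and
of this line (`stub_eds7`, `stub_eds8`, `stub_eds9`, `stub_eds10` — kernel-checked tables) through the
spanning transfer `stub_spanTransfer` give the weight slices `SpanAt N` of the crux for every `N ≤ 10`:
every MZV word generator `[Δ_N, q·∏ ω_ε]` of weight `N ≤ 10` is congruent modulo `KZ.relations` to a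
`ℤ`-combination of Hoffman generators `[Δ_N, q'·ω_u]`, `u ∈ {2,3}^×`, `|u| = N` — `512` word types, no
transcendence input, every intermediate representation absolutely convergent. What remains of the crux is
the tail `∀ N ≥ 11, EdsCertificate N` (completeness of finite double shuffle + Hoffman's relation + duality
in every weight; Ihara–Kaneko–Zagier 2006, Conj. 1 strength), the one open stub of the skeleton
`Cruxes/HoffmanSpanInKZ/Lines/Sketch.lean`.

Sources: F. Brown, Ann. of Math. 175 (2012), Thm 1.1; K. Ihara, M. Kaneko, D. Zagier, Compos. Math. 142
(2006), §1; M. Kontsevich, D. Zagier, *Periods* (2001), §1.2.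
-/

noncomputable section

namespace Summit.KontsevichZagierPeriods.LinRedNormalForm.HoffmanSpanInKZ

open Literature.NumberTheory.Transcendental
open Summit.KontsevichZagierPeriods.MzvKernelInKZ.Negative
open Summit.KontsevichZagierPeriods.MzvKernelInKZ.TwoPosets

/-- EDS certificates through weight `10`: the tree's `N ≤ 6` and the four landed tables. -/
theorem edsCertificate_of_le_ten {N : ℕ} (h : N ≤ 10) : EdsCertificate N := by
  rcases Nat.lt_or_ge N 7 with h7 | h7
  · exact stub_edsCertificateLow N (by omega)
  · interval_cases N
    · exact stub_eds7
    · exact stub_eds8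
    · exact stub_eds9
    · exact stub_eds10

/-- **The crux through weight `10`, unconditionally**: every MZV word generator of weight `N ≤ 10` is
congruent modulo `KZ.relations` to a `ℤ`-combination of Hoffman generators of weight `N`. -/
theorem spanAt_of_le_ten {N : ℕ} (h : N ≤ 10) : SpanAt N :=
  stub_spanTransfer N (edsCertificate_of_le_ten h)

/-- The weight slices of the crux through weight `10`, as one statement. -/
def LeTen : Prop := ∀ N : ℕ, N ≤ 10 → SpanAt N

/-- **Registered stub `stub_leTen`** (milestone of line `Sketch`): the crux holds in every weight `≤ 10`. -/
theorem stub_leTen : LeTen := fun _ h => spanAt_of_le_ten h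

end Summit.KontsevichZagierPeriods.LinRedNormalForm.HoffmanSpanInKZ
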